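import Literature.Barriers.ResolutionOfSingularities.LocalMonomializationFailsEndgame
import Mathlib.RingTheory.Localization.Integer
import Mathlib.RingTheory.EssentialFiniteness
import Mathlib.FieldTheory.IntermediateField.Adjoin.Algebra
import HarnessLib

/-!
# Cutkosky's counterexample: Theorem 1.4 from the four named facts

`Literature/Barriers/ResolutionOfSingularities/LocalMonomializationFailsProofs.lean` — the
CONDITIONAL assembly of the named fact
`Literature.Barriers.ResolutionOfSingularities.Cutkosky.Cutkosky2014` (Theorem 1.4 of Cutkosky,
Math. Ann. 362 (2015), `LocalMonomializationFails.lean`) from the four named sub-facts of its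
decomposition: `AbhyankarQuadraticFactorization` (Thm. 2.1 = Abhyankar 1956 Thm. 3),
`AbhyankarQuadraticUnion` (Lemma 2.2 = Abhyankar 1956 Lemma 12), `CutkoskyLemma31` (Lemma 3.1)
and `CutkoskyMonomialPersists` (§3 p. 7). Everything else of §3 is PROVED in the sibling files
(`…Setup`, `…Towers`, `…Valuation`, `…ClassA`, `…Endgame`); this file performs the reduction of
the general case `n ≥ 2` to the base field `F = k(t₁, …, t_{n−2})` (p. 7: "Let `k' = k(t₁,…,t_r)`.
Then `K` and `K*` are two dimensional algebraic function fields over `k'` … any algebraic local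
ring of `K*/k` which dominates `B` must contain `k'` so is also an algebraic local ring of
`K*/k'`") and packages the data of Theorem 1.4: `K* = L = F(x,y)`, `K = F(u,v)`,
`A = F[u,v]_{(u,v)} = k[t,u,v]_{(u,v)}`, `B = k[t,x,y]_{(x,y)}`, `ν* ↔ V*`.
Main result: `Cutkosky2014_of_facts`. [cite: Cutkosky2014, Thm. 1.4 and §3 (p. 7)]
-/

noncomputable section

namespace Literature.Barriers.ResolutionOfSingularities

namespace Cutkosky

open Literature.AlgebraicGeometry.Resolution IsLocalRing
open scoped IntermediateField

/-! ## Base change of subalgebras between `k` and `F ⊇ k` -/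

section BaseChange

variable {k F L : Type} [Field k] [Field F] [Field L] [Algebra k F] [Algebra F L] [Algebra k L]
  [IsScalarTower k F L]

/-- A `k`-subalgebra containing the scalars from `F`, as an `F`-subalgebra (same carrier).
[folklore] -/
def toF (S : Subalgebra k L) (hF : ∀ c : F, algebraMap F L c ∈ S) : Subalgebra F L :=
  { S.toSubring with algebraMap_mem' := hF }

omit [Algebra k F] [IsScalarTower k F L] in
/-- Same carrier. [folklore] -/
@[simp] theorem mem_toF {S : Subalgebra k L} {hF : ∀ c : F, algebraMap F L c ∈ S} {z : L} :
    z ∈ toF S hF ↔ z ∈ S := Iff.rfl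

/-- **An algebraic local ring over `k` containing `F` is an algebraic local ring over `F`**
("any algebraic local ring of `K*/k` which dominates `B` must contain `k'` so is also an algebraic
local ring of `K*/k'`", Cutkosky p. 7): the finitely generated model over `F` is generated by the
same finite set. [cite: Cutkosky2014, §3 (p. 7)] -/
theorem isAlgebraicLocalRingOf_toF (K : IntermediateField F L) (S : Subalgebra k L)
    (hF : ∀ c : F, algebraMap F L c ∈ S)
    (h : IsAlgebraicLocalRingOf k L (K.restrictScalars k) S) :
    IsAlgebraicLocalRingOf F L K (toF S hF) := by
  obtain ⟨hloc, hsub, hfrac, R, ⟨s, hs⟩, hRS, hfr⟩ := h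
  refine ⟨hloc, hsub, hfrac, Algebra.adjoin F (s : Set L), ⟨s, rfl⟩, ?_, ?_⟩
  · refine Algebra.adjoin_le fun z hz => ?_
    exact hRS (hs ▸ Algebra.subset_adjoin hz)
  · intro z hz
    obtain ⟨r, hr, s', hs', hs'0, hsinv, hzrs⟩ := hfr z hz
    have hle : R ≤ (Algebra.adjoin F (s : Set L)).restrictScalars k := by
      rw [← hs]; exact Algebra.adjoin_le Algebra.subset_adjoin
    exact ⟨r, hle hr, s', hle hs', hs'0, hsinv, hzrs⟩

end BaseChange

/-! ## The concrete fields `F = k(t₁,…,t_r)`, `L = F(x,y)` -/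

section Concrete

variable (k : Type) [Field k] (r : ℕ)

/-- `F = k(t₁, …, t_r)`. [cite: Cutkosky2014, §3 (p. 7)] -/
abbrev baseF : Type := FractionRing (MvPolynomial (Fin r) k)

/-- `L = K* = F(x, y)`. [cite: Cutkosky2014, §3] -/
abbrev topL : Type := FractionRing (MvPolynomial (Fin 2) (baseF k r))

/-- `x, y ∈ L`. [cite: Cutkosky2014, §3] -/
def xy : Fin 2 → topL k r := fun i => algebraMap (MvPolynomial (Fin 2) (baseF k r)) (topL k r) (MvPolynomial.X i)

/-- `x, y` are algebraically independent over `F`. [cite: Cutkosky2014, §3] -/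
theorem algebraicIndependent_xy : AlgebraicIndependent (baseF k r) (xy k r) :=
  (MvPolynomial.algebraicIndependent_X (Fin 2) (baseF k r)).map'
    (f := IsScalarTower.toAlgHom (baseF k r) (MvPolynomial (Fin 2) (baseF k r)) (topL k r))
    (IsFractionRing.injective _ _)

/-- `x, y` as the pair `![x, y]`. [folklore] -/
theorem xy_eq : xy k r = ![xy k r 0, xy k r 1] := (pair_eta _).symm

/-- Polynomials in `x, y` lie in every intermediate field containing `x, y`. [folklore] -/
theorem algebraMap_mem_adjoin (f : MvPolynomial (Fin 2) (baseF k r)) :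
    algebraMap _ (topL k r) f ∈ IntermediateField.adjoin (baseF k r) (Set.range (xy k r)) := by
  induction f using MvPolynomial.induction_on with
  | C a =>
    rw [← MvPolynomial.algebraMap_eq, ← IsScalarTower.algebraMap_apply]
    exact IntermediateField.algebraMap_mem _ a
  | add f g hf hg => rw [map_add]; exact add_mem hf hg
  | mul_X f i hf => rw [map_mul]; exact mul_mem hf (IntermediateField.subset_adjoin _ _ ⟨i, rfl⟩)

/-- **`L = F(x, y)`.** [cite: Cutkosky2014, §3] -/
theorem adjoin_xy_eq_top :
    IntermediateField.adjoin (baseF k r) {xy k r 0, xy k r 1} = ⊤ := by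
  rw [← range_pair, ← xy_eq, eq_top_iff]
  intro z _
  obtain ⟨a, b, -, rfl⟩ := IsFractionRing.div_surjective (A := MvPolynomial (Fin 2) (baseF k r)) z
  exact div_mem (algebraMap_mem_adjoin k r a) (algebraMap_mem_adjoin k r b)

/-- `![x, y]` is algebraically independent over `F`. [cite: Cutkosky2014, §3] -/
theorem algebraicIndependent_xy_pair : AlgebraicIndependent (baseF k r) ![xy k r 0, xy k r 1] := by
  rw [← xy_eq]; exact algebraicIndependent_xy k r

/-- `F ⊇ k` has at least three elements if `k` does. [cite: Cutkosky2014, Thm. 1.4] -/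
theorem three_elements (h3 : ∃ a b c : k, a ≠ b ∧ b ≠ c ∧ a ≠ c) :
    ∃ a b c : baseF k r, a ≠ b ∧ b ≠ c ∧ a ≠ c := by
  obtain ⟨a, b, c, hab, hbc, hac⟩ := h3
  have hinj := (algebraMap k (baseF k r)).injective
  exact ⟨_, _, _, fun h => hab (hinj h), fun h => hbc (hinj h), fun h => hac (hinj h)⟩

/-- `char F = p`. [folklore] -/
theorem charP_baseF (p : ℕ) [CharP k p] : CharP (baseF k r) p := charP_of_algebra_field k p (baseF k r)

/-- The scalar tower `k → F → L`. [folklore] -/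
example : IsScalarTower k (baseF k r) (topL k r) := inferInstance

end Concrete

/-! ## Function field data over `k` -/

section FunctionField

variable (k : Type) [Field k] (r : ℕ)

/-- `L = F(x,y)` is essentially of finite type over `k`. [folklore] -/
theorem essFiniteType_topL : Algebra.EssFiniteType k (topL k r) := by
  haveI : Algebra.EssFiniteType k (MvPolynomial (Fin 2) (baseF k r)) :=
    Algebra.EssFiniteType.comp k (baseF k r) (MvPolynomial (Fin 2) (baseF k r))
  infer_instance

/-- `trdeg_k F = r`. [folklore] -/
theorem trdeg_baseF : Algebra.trdeg k (baseF k r) = r := by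
  haveI : Algebra.IsAlgebraic (MvPolynomial (Fin r) k) (baseF k r) :=
    IsLocalization.isAlgebraic (baseF k r) (nonZeroDivisors (MvPolynomial (Fin r) k))
  have h := trdeg_add_eq k (MvPolynomial (Fin r) k) (A := baseF k r)
  rw [trdeg_eq_zero (R := MvPolynomial (Fin r) k) (A := baseF k r), add_zero,
    MvPolynomial.trdeg_of_isDomain] at h
  rw [← h]
  simp

/-- **`trdeg_k L = r + 2`** ("`n` dimensional function fields"). [cite: Cutkosky2014, Thm. 1.4] -/
theorem trdeg_topL : Algebra.trdeg k (topL k r) = r + 2 := by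
  have h := trdeg_add_eq k (baseF k r) (A := topL k r)
  rw [trdeg_L (algebraicIndependent_xy_pair k r) (adjoin_xy_eq_top k r), trdeg_baseF] at h
  exact h.symm

/-- **`L` is an `(r+2)`-dimensional function field over `k`.** [cite: Cutkosky2014, Thm. 1.4] -/
theorem isFunctionFieldOfDim_topL : IsFunctionFieldOfDim k (topL k r) (r + 2) :=
  ⟨IntermediateField.fg_top_iff.mpr (essFiniteType_topL k r), by rw [trdeg_topL]; norm_cast⟩

variable (p : ℕ) [Fact p.Prime] [CharP k p]

/-- `K = F(u,v)` as an intermediate field over `k`. [cite: Cutkosky2014, §3 (p. 7)] -/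
def Kk : IntermediateField k (topL k r) :=
  haveI : CharP (baseF k r) p := charP_baseF k r p
  (Kuv (baseF k r) p (xy k r 0) (xy k r 1)).restrictScalars k

/-- **`K` is an `(r+2)`-dimensional function field over `k`** (`K = k(t)(u,v)`, `L/K` algebraic).
[cite: Cutkosky2014, Thm. 1.4] -/
theorem isFunctionFieldOfDim_Kk : IsFunctionFieldOfDim k (Kk k r p) (r + 2) := by
  haveI : CharP (baseF k r) p := charP_baseF k r p
  set K := Kuv (baseF k r) p (xy k r 0) (xy k r 1)
  -- the `F`-algebra structure of `K` (same carrier as `Kk`)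
  letI : Algebra (baseF k r) (Kk k r p) := K.algebra
  haveI : IsScalarTower k (baseF k r) (Kk k r p) :=
    IsScalarTower.of_algebraMap_eq fun c => Subtype.ext (IsScalarTower.algebraMap_apply k (baseF k r) (topL k r) c)
  have hfg : K.FG := IntermediateField.fg_adjoin_of_finite (Set.toFinite _)
  haveI : Algebra.EssFiniteType (baseF k r) (Kk k r p) := IntermediateField.essFiniteType_iff.mpr hfg
  haveI : Algebra.EssFiniteType k (Kk k r p) := Algebra.EssFiniteType.comp k (baseF k r) (Kk k r p)
  refine ⟨IntermediateField.fg_top_iff.mpr inferInstance, ?_⟩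
  have h := trdeg_add_eq k (baseF k r) (A := Kk k r p)
  have h2 : Algebra.trdeg (baseF k r) (Kk k r p) = 2 :=
    trdeg_Kuv p (algebraicIndependent_xy_pair k r) (adjoin_xy_eq_top k r)
  rw [h2, trdeg_baseF] at h
  rw [← h]
  norm_cast

/-- `L` is finite over `K`. [cite: Cutkosky2014, §3] -/
theorem finiteDimensional_Kk : FiniteDimensional (Kk k r p) (topL k r) :=
  haveI : CharP (baseF k r) p := charP_baseF k r p
  finiteDimensional_Kuv (baseF k r) p (adjoin_xy_eq_top k r)

/-- `L` is separable over `K`. [cite: Cutkosky2014, §3] -/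
theorem isSeparable_Kk : Algebra.IsSeparable (Kk k r p) (topL k r) :=
  haveI : CharP (baseF k r) p := charP_baseF k r p
  isSeparable_Kuv (baseF k r) p (adjoin_xy_eq_top k r) (algebraicIndependent_xy_pair k r)

end FunctionField

/-! ## The algebraic local rings `A`, `B` over `k` -/

section Rings

variable (k : Type) [Field k] (r : ℕ)

/-- The images of `t₁, …, t_r` in `L`. [cite: Cutkosky2014, §3 (p. 7)] -/
def tL (i : Fin r) : topL k r :=
  algebraMap (baseF k r) (topL k r) (algebraMap (MvPolynomial (Fin r) k) (baseF k r) (MvPolynomial.X i))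

/-- **`F[z]_{(z)} = k[t, z]_{(z)}` is an algebraic local ring over `k`** (of the function field
`K ⊇ F[z]_{(z)}` of which every element is a fraction of its elements): the finitely generated
model over `k` is `k[t, z]`; a fraction `f(z)/g(z)` with coefficients in `F = k(t)` becomes one with
coefficients in `k[t]` after clearing the finitely many denominators. [cite: Cutkosky2014, §3 (p. 7)] -/
theorem isAlgebraicLocalRingOf_restrictScalars {n : ℕ} {z : Fin n → topL k r}
    (hz : AlgebraicIndependent (baseF k r) z) (K : IntermediateField (baseF k r) (topL k r))
    (hK : (originLocalRing hz).toSubring ≤ K.toSubring)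
    (hfrac : ∀ w ∈ K, ∃ a ∈ originLocalRing hz, ∃ b ∈ originLocalRing hz, b ≠ 0 ∧ w = a / b) :
    IsAlgebraicLocalRingOf k (topL k r) (K.restrictScalars k) ((originLocalRing hz).restrictScalars k) := by
  -- the model `k[t, z]`
  have hRA : Algebra.adjoin k (Set.range (tL k r) ∪ Set.range z) ≤ (originLocalRing hz).restrictScalars k := by
    refine Algebra.adjoin_le ?_
    rintro w (⟨i, rfl⟩ | ⟨i, rfl⟩)
    · exact (originLocalRing hz).algebraMap_mem _
    · exact mem_originLocalRing_self hz i
  have hPoly : ∀ e : MvPolynomial (Fin r) k,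
      algebraMap (baseF k r) (topL k r) (algebraMap (MvPolynomial (Fin r) k) (baseF k r) e) ∈
        Algebra.adjoin k (Set.range (tL k r) ∪ Set.range z) := by
    intro e
    induction e using MvPolynomial.induction_on with
    | C a =>
      rw [← MvPolynomial.algebraMap_eq, ← IsScalarTower.algebraMap_apply, ← IsScalarTower.algebraMap_apply]
      exact Subalgebra.algebraMap_mem _ a
    | add f g hf hg => rw [map_add, map_add]; exact add_mem hf hg
    | mul_X f i hf =>
      rw [map_mul, map_mul]
      exact mul_mem hf (Algebra.subset_adjoin (Or.inl ⟨i, rfl⟩))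
  refine ⟨isLocalRing_originLocalRing hz, fun w hw => hK hw, fun w hw => hfrac w hw,
    Algebra.adjoin k (Set.range (tL k r) ∪ Set.range z),
    ⟨((Set.finite_range (tL k r)).union (Set.finite_range z)).toFinset, by rw [Set.Finite.coe_toFinset]⟩,
    hRA, ?_⟩
  intro q hq
  obtain ⟨f, g, hg0, rfl⟩ := (mem_originLocalRing_iff hz).mp hq
  classical
  -- clear the denominators of the coefficients of `f` and `g`
  obtain ⟨⟨d, hdM⟩, hd⟩ := IsLocalization.exist_integer_multiples_of_finset
    (nonZeroDivisors (MvPolynomial (Fin r) k)) (f.support.image f.coeff ∪ g.support.image g.coeff)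
  have hd0 : d ≠ 0 := nonZeroDivisors.ne_zero hdM
  have hD0 : algebraMap (MvPolynomial (Fin r) k) (baseF k r) d ≠ 0 := by
    intro h
    exact hd0 ((IsFractionRing.injective (MvPolynomial (Fin r) k) (baseF k r)) (by rw [map_zero]; exact h))
  have hDL0 : algebraMap (baseF k r) (topL k r) (algebraMap (MvPolynomial (Fin r) k) (baseF k r) d) ≠ 0 := by
    rw [map_ne_zero]; exact hD0
  have hmemR : ∀ h : MvPolynomial (Fin n) (baseF k r),
      (∀ m ∈ h.support, h.coeff m ∈ f.support.image f.coeff ∪ g.support.image g.coeff) →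
      algebraMap (baseF k r) (topL k r) (algebraMap (MvPolynomial (Fin r) k) (baseF k r) d) *
        MvPolynomial.aeval z h ∈ Algebra.adjoin k (Set.range (tL k r) ∪ Set.range z) := by
    intro h hh
    rw [MvPolynomial.aeval_def, MvPolynomial.eval₂_eq, Finset.mul_sum]
    refine Subalgebra.sum_mem _ fun m hm => ?_
    obtain ⟨e, he⟩ := hd _ (hh m hm)
    rw [Algebra.smul_def] at he
    rw [← mul_assoc, ← map_mul, ← he]
    refine Subalgebra.mul_mem _ (hPoly e) (Subalgebra.prod_mem _ fun i _ => ?_)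
    have hzi : z i ∈ Algebra.adjoin k (Set.range (tL k r) ∪ Set.range z) :=
      Algebra.subset_adjoin (Or.inr ⟨i, rfl⟩)
    exact Subalgebra.pow_mem _ hzi _
  have hfC : ∀ m ∈ f.support, f.coeff m ∈ f.support.image f.coeff ∪ g.support.image g.coeff := fun m hm =>
    Finset.mem_union_left _ (Finset.mem_image_of_mem _ hm)
  have hgC : ∀ m ∈ g.support, g.coeff m ∈ f.support.image f.coeff ∪ g.support.image g.coeff := fun m hm =>
    Finset.mem_union_right _ (Finset.mem_image_of_mem _ hm)
  have hg0' : MvPolynomial.aeval z g ≠ 0 := aeval_ne_zero_of_constantCoeff_ne_zero hz hg0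
  refine ⟨_, hmemR f hfC, _, hmemR g hgC, mul_ne_zero hDL0 hg0', ?_, ?_⟩
  · -- the denominator is a unit of `A`
    rw [mul_inv_rev, ← map_inv₀ (algebraMap (baseF k r) (topL k r))]
    refine (originLocalRing hz).mul_mem ?_ ((originLocalRing hz).algebraMap_mem _)
    have h1 : MvPolynomial.aeval z 1 / MvPolynomial.aeval z g ∈ originLocalRing hz :=
      (mem_originLocalRing_iff hz).mpr ⟨1, g, hg0, rfl⟩
    rwa [map_one, one_div] at h1
  · rw [mul_div_mul_left _ _ hDL0]

end Rings

/-! ## Theorem 1.4 from the four named facts -/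

/-- **Cutkosky's Theorem 1.4 from its named sub-facts.** Granted Abhyankar's factorization theorem
and union lemma (Cutkosky Thm. 2.1 / Lemma 2.2), Cutkosky's Lemma 3.1 and the persistence of
monomial forms along quadratic transforms of the source (§3 p. 7), the counterexample to local and
weak local monomialization in positive characteristic holds: `Cutkosky2014`.
[cite: Cutkosky2014, Thm. 1.4] -/
theorem Cutkosky2014_of_facts (hF : AbhyankarQuadraticFactorization.{0}) (hU : AbhyankarQuadraticUnion.{0})
    (hL : CutkoskyLemma31.{0}) (hP : CutkoskyMonomialPersists.{0}) : Cutkosky2014 := by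
  intro k _ p _ hp h3 n hn
  haveI : Fact p.Prime := ⟨hp⟩
  obtain ⟨r, rfl⟩ : ∃ r, n = r + 2 := ⟨n - 2, by omega⟩
  haveI : CharP (baseF k r) p := charP_baseF k r p
  have hxy := algebraicIndependent_xy_pair k r
  have hgen := adjoin_xy_eq_top k r
  have h3F := three_elements k r h3
  have huv := algebraicIndependent_uv (baseF k r) p hgen hxy
  refine ⟨topL k r, inferInstance, inferInstance, Kk k r p, isFunctionFieldOfDim_topL k r,
    isFunctionFieldOfDim_Kk k r p, finiteDimensional_Kk k r p, isSeparable_Kk k r p,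
    Vstar p hxy hgen h3F hL, (originLocalRing huv).restrictScalars k, (originLocalRing hxy).restrictScalars k,
    ?_, ?_, isRegularLocalRing_originLocalRing huv, isRegularLocalRing_originLocalRing hxy,
    dominates_A_B p hxy huv, ?_, ?_⟩
  · -- `A` is an algebraic local ring of `K` over `k`
    refine isAlgebraicLocalRingOf_restrictScalars k r huv _ ?_ ?_
    · refine originLocalRing_le_intermediateField huv _ (Fin.forall_fin_two.mpr ⟨?_, ?_⟩)
      · exact cu_mem_Kuv (baseF k r) p
      · exact cv_mem_Kuv (baseF k r) p
    · intro w hw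
      have hw' : w ∈ IntermediateField.adjoin (baseF k r) (Set.range ![cu p (xy k r 0) (xy k r 1), cv p (xy k r 0) (xy k r 1)]) := by
        rw [range_pair]; exact hw
      obtain ⟨a, b, rfl⟩ := (IntermediateField.mem_adjoin_range_iff (baseF k r) _ _).mp hw'
      by_cases hb : MvPolynomial.aeval ![cu p (xy k r 0) (xy k r 1), cv p (xy k r 0) (xy k r 1)] b = 0
      · exact ⟨0, Subalgebra.zero_mem _, 1, Subalgebra.one_mem _, one_ne_zero, by rw [hb]; simp⟩
      · exact ⟨_, aeval_mem_originLocalRing huv a, _, aeval_mem_originLocalRing huv b, hb, rfl⟩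
  · -- `B` is an algebraic local ring of `L` over `k`
    have h := isAlgebraicLocalRingOf_restrictScalars k r hxy ⊤ le_top ?_
    · rwa [IntermediateField.restrictScalars_top] at h
    · intro w _
      have hw' : w ∈ IntermediateField.adjoin (baseF k r) (Set.range ![xy k r 0, xy k r 1]) := by
        rw [range_pair, hgen]; exact IntermediateField.mem_top
      obtain ⟨a, b, rfl⟩ := (IntermediateField.mem_adjoin_range_iff (baseF k r) _ _).mp hw'
      by_cases hb : MvPolynomial.aeval ![xy k r 0, xy k r 1] b = 0
      · exact ⟨0, Subalgebra.zero_mem _, 1, Subalgebra.one_mem _, one_ne_zero, by rw [hb]; simp⟩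
      · exact ⟨_, aeval_mem_originLocalRing hxy a, _, aeval_mem_originLocalRing hxy b, hb, rfl⟩
  · -- `ν*` dominates `B = B₀`
    have h := dominates_Bring_Vstar p hxy hgen h3F hL 0
    rw [Bring_zero] at h
    exact h
  · -- no weak local monomialization: reduce to the base field `F`
    rintro ⟨A', B', hle, hA', hB', hrA, hrB, hVB, hAB, hAA, hBB, hmono⟩
    have hFA : ∀ c : baseF k r, algebraMap (baseF k r) (topL k r) c ∈ A' :=
      fun c => hAA.1 ((originLocalRing huv).algebraMap_mem c)
    have hFB : ∀ c : baseF k r, algebraMap (baseF k r) (topL k r) c ∈ B' :=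
      fun c => hBB.1 ((originLocalRing hxy).algebraMap_mem c)
    refine noWeakLocalMonomialization_F p hxy hgen h3F hL hF hU hP
      ⟨toF A' hFA, toF B' hFB, hle, isAlgebraicLocalRingOf_toF _ A' hFA hA', ?_, hrA, hrB, hVB, hAB, hAA, hBB, hmono⟩
    have hB'' : IsAlgebraicLocalRingOf k (topL k r) ((⊤ : IntermediateField (baseF k r) (topL k r)).restrictScalars k) B' := by
      rwa [IntermediateField.restrictScalars_top]
    exact isAlgebraicLocalRingOf_toF _ B' hFB hB''

end Cutkosky

end Literature.Barriers.ResolutionOfSingularities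

end
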